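import Mathlib
import HarnessLib

/-!
# Caffarelli's contraction theorem, two-sided (sandwich) form
# (Caffarelli 2000, Thm 11; Kolesnikov 2011, Thm 2.2; Caffarelli 1992 regularity)

Setting [cite: Kolesnikov2011, Thm 2.2 (L. Caffarelli)]: "Let `T = ∇Φ` be the optimal transportation
mapping pushing forward a probability measure `μ = e^{−V} dx` onto a probability measure `ν = e^{−W} dx`.
Assume that `V` and `W` are twice continuously differentiable and `D²W ≥ K`. Then for every unit
vector `e`, `sup_x Φ_ee² ≤ (1/K) sup_x V_ee`. In particular, if `μ` is the standard Gaussian measure and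
`K ≥ 1`, then `T` is a contraction."  The original statement is [cite: Caffarelli2000, Thm 11];
the proof there and in [cite: Kolesnikov2011, §2 (proof of Thm 2.2, Lemma 2.3–2.4)] proceeds by
approximation ("one can assume that supp(ν) is a bounded convex domain and V, W are locally Hölder;
Caffarelli's regularity theory assures that `Φ ∈ C^{2,α}_loc(ℝ^d)`" — the interior regularity of
[cite: Caffarelli1992, Thm 1–2]).

TYPED CONSEQUENCE (the form used by the Yang–Mills route `LogConcaveChart`, item
`SandwichTransportMap`): let `H₀ ≻ 0` and let `A : ℝⁿ → ℝ` be continuous with the two-sided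
second-difference sandwich `(1−δ)·hᵀH₀h ≤ A(x+h) + A(x−h) − 2A(x) ≤ (1+δ)·hᵀH₀h` for all `x, h`,
`0 ≤ δ ≤ 1/2` (so `A ∈ C^{1,1}` with `D²A ∈ [(1−δ)H₀, (1+δ)H₀]` a.e.; `e^{−A}` is integrable with all
moments).  In the frame `y = H₀^{1/2} x` the Brenier map `T̃ = ∇Φ` from the standard Gaussian to the
image of `e^{−A}dx/Z` has, by Thm 2.2 applied to `T̃` (source Hessian `= I`, target Hessian `≥ 1−δ`)
and to `T̃⁻¹` (source Hessian `≤ 1+δ`, target `= I`; `D²Φ = (D²Φ*)⁻¹ ∘ ∇Φ`), a symmetric Jacobian with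
spectrum in `[(1+δ)^{−1/2}, (1−δ)^{−1/2}] ⊂ [1−δ, 1+δ]` (elementary for `δ ≤ 1/2`), i.e.
`‖DT̃ − I‖_op ≤ δ`, hence `T̃ − id` is `δ`-Lipschitz; `T̃ ∈ C¹` by the `C^{2,α}_loc` regularity (both
densities are positive and locally Lipschitz on `ℝⁿ`).  Conjugating back, `T = H₀^{−1/2} T̃ H₀^{1/2}`
is `C¹`, pushes `γ_{H₀} = e^{−xᵀH₀x/2}dx/Z₀` to `e^{−A}dx/Z_A` — written as the equality of
NORMALISED Lebesgue integrals for every measurable `F` (both sides are `0` by the Bochner convention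
exactly when `F ∉ L¹(ν)`, equivalently `F ∘ T ∉ L¹(γ_{H₀})`) — and satisfies the two `H₀`-metric
bounds below.  No smallness of `δ` beyond `δ ≤ 1/2` and no dimension dependence enter.

Nothing in this file is a claim about the Yang–Mills mass gap; it is a named fact of optimal
transport, not proved here (Mathlib has no Monge–Ampère / Brenier regularity theory).
-/

namespace Literature.Probability.TransportMaps

/-- **Caffarelli–Kolesnikov two-sided contraction for a `(1 ± δ)H₀` Hessian sandwich**
[cite: Kolesnikov2011, Thm 2.2 (applied to the Brenier map and to its inverse)]
[cite: Caffarelli2000, Thm 11] [cite: Caffarelli1992, Thm 1–2 (C^{2,α} interior regularity ⇒ T ∈ C¹)]: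
for `0 ≤ δ ≤ 1/2`, `H₀` positive definite and `A` continuous with
`(1−δ)hᵀH₀h ≤ A(x+h)+A(x−h)−2A(x) ≤ (1+δ)hᵀH₀h` for all `x, h`, there is a `C¹` map `T : ℝⁿ → ℝⁿ`
with `(∫ F(Tx) e^{−xᵀH₀x/2} dx)/(∫ e^{−xᵀH₀x/2} dx) = (∫ F e^{−A} dx)/(∫ e^{−A} dx)` for every
measurable `F`, `(T − id)` `δ`-Lipschitz in the `H₀`-metric, and `‖DT(x) − I‖_{H₀} ≤ δ` for all `x`.
Named fact, not proved here. -/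
def Caffarelli2000_sandwichBrenierMap : Prop :=
  ∀ δ : ℝ, 0 ≤ δ → δ ≤ 1 / 2 → ∀ (n : ℕ) (H₀ : Matrix (Fin n) (Fin n) ℝ) (A : (Fin n → ℝ) → ℝ),
    H₀.PosDef → Continuous A →
    (∀ x h : Fin n → ℝ, (1 - δ) * (h ⬝ᵥ H₀.mulVec h) ≤ A (x + h) + A (x - h) - 2 * A x ∧
      A (x + h) + A (x - h) - 2 * A x ≤ (1 + δ) * (h ⬝ᵥ H₀.mulVec h)) →
    ∃ T : (Fin n → ℝ) → (Fin n → ℝ), ContDiff ℝ 1 T ∧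
      (∀ F : (Fin n → ℝ) → ℝ, Measurable F →
        (∫ x, F (T x) * Real.exp (-(x ⬝ᵥ H₀.mulVec x) / 2)) /
            (∫ x : Fin n → ℝ, Real.exp (-(x ⬝ᵥ H₀.mulVec x) / 2)) =
          (∫ x, F x * Real.exp (-A x)) / ∫ x, Real.exp (-A x)) ∧
      (∀ x y : Fin n → ℝ, (T x - T y - (x - y)) ⬝ᵥ H₀.mulVec (T x - T y - (x - y)) ≤
        δ ^ 2 * ((x - y) ⬝ᵥ H₀.mulVec (x - y))) ∧
      (∀ x u : Fin n → ℝ, (fderiv ℝ T x u - u) ⬝ᵥ H₀.mulVec (fderiv ℝ T x u - u) ≤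
        δ ^ 2 * (u ⬝ᵥ H₀.mulVec u))

end Literature.Probability.TransportMaps
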